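import Mathlib
import HarnessLib
import Summits.MatrixMultiplication.MatrixMultiplication.Theses.SnSubsetDichotomy
import Literature.Combinatorics.Additive.TripleProductProperty
import Literature.RepresentationTheory.FiniteGroups.CharacterDegrees
import Literature.RepresentationTheory.FiniteGroups.VershikKerovMaxDegree
import Literature.GroupTheory.PermutationGroups.PrimitiveGroupOrder

/-!
# Sketch — crux-ideate stmt-MatrixMultiplication-8303 (GlobalBranch), round 1, ideator 1

First lemmas of the two idea cards (statements only, every `def … : Prop` elaborates; no sorry):

* card `quotient-cayley-clique`: `quot`, `CocliqueReformulation`, `CliqueReformulation`,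
  `CliqueCocliqueTPP` (NEW inequality `|S|(|T|+|U|-1) ≤ |G|`), `DelsarteCocliqueBound`
  (weak duality with a positive-definite certificate), `SubgroupCliqueBound`,
  `QuotDisjoint`, `HyperHosted`, `PairCliqueDichotomy` (crux-level conjecture about PAIRS),
  glue `CliqueLineToGlobalBranch`; alternative quotient-side formulation `HostDichotomy`,
  `HostToGlobalBranch` (+ `QuotInSubgroupIffRightCoset`, `StabHostIsUmvirate`, `PraegerSaxl1980`,
  `LargeSubgroupNotPrimitive`).
* card `psd-hexagon-cubic-packing`: `HexagonCount`, `PairQuotientCount`, `CubicPackingSn`,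
  `BumpFreeCubicPacking` (C⁺), `CubesLeMaxDegMulOrder`, glue `CubicToGlobalBranch`.
-/

namespace Summit.MatrixMultiplication.MatrixMultiplication.Cruxes.GlobalBranch.Sketch

open Literature.Combinatorics.Additive Literature.RepresentationTheory.FiniteGroups
open Summit.MatrixMultiplication.MatrixMultiplication.Theses.SnSubsetDichotomy

/-! ## Common notation -/

/-- Right quotient set `Q(X) = {x x'⁻¹ : x, x' ∈ X}` (Cohn–Umans 2003, Def. 2.1). -/
def quot {G : Type*} [Group G] [DecidableEq G] (X : Finset G) : Finset G :=
  Finset.image₂ (fun x x' => x * x'⁻¹) X X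

/-- The connection set `E = Q(U)·Q(T) ∪ Q(T)·Q(U)` of the quotient Cayley graph. -/
def conn {G : Type*} [Group G] [DecidableEq G] (T U : Finset G) : Finset G :=
  Finset.image₂ (· * ·) (quot U) (quot T) ∪ Finset.image₂ (· * ·) (quot T) (quot U)

/-- Bump-freeness of one set `X ⊆ S_n` at parameter `ε` up to level `√n`
(verbatim the hypothesis of `GlobalBranch`). -/
def BumpFree (ε : ℝ) {n : ℕ} (X : Finset (Equiv.Perm (Fin n))) : Prop :=
  ∀ t : ℕ, 1 ≤ t → (t : ℝ) ≤ Real.sqrt (n : ℝ) → ∀ I L : Fin t → Fin n,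
    Function.Injective I → Function.Injective L →
      ((X.filter (fun σ => ∀ k, σ (I k) = L k)).card : ℝ) * (n.descFactorial t : ℝ) ≤
        (n : ℝ) ^ ((1 / 2 + ε) * t) * (X.card : ℝ)

/-! ## Card 1 — quotient-cayley-clique -/

/-- TPP ⇒ `S` is a coclique of `Cay(G, E)`, `E = Q(U)Q(T) ∪ Q(T)Q(U)`: no two distinct elements
of `S` differ (on the right) by an element of `E`. Provable now (two applications of the TPP,
orderings (S,U,T) and (S,T,U); TPP is invariant under permuting the three sets). -/
def CocliqueReformulation : Prop :=
  ∀ (G : Type) [Group G] [DecidableEq G] (S T U : Finset G), TripleProductProperty S T U →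
    ∀ s ∈ S, ∀ s' ∈ S, s ≠ s' → s * s'⁻¹ ∉ conn T U

/-- TPP and `1 ∈ T ∩ U` ⇒ `T ∪ U` is a clique of the same Cayley graph and `T ∩ U = {1}`.
Provable now. -/
def CliqueReformulation : Prop :=
  ∀ (G : Type) [Group G] [DecidableEq G] (S T U : Finset G), TripleProductProperty S T U →
    (1 : G) ∈ T → (1 : G) ∈ U →
      T ∩ U = {1} ∧ ∀ k ∈ T ∪ U, ∀ k' ∈ T ∪ U, k ≠ k' → k * k'⁻¹ ∈ conn T U

/-- **Clique–coclique inequality for TPP triples (new, any finite group):**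
`|S| · (|T| + |U| − 1) ≤ |G|`. From the two reformulations, right-translating `T`, `U` to contain
`1`, and `α(Γ)·ω(Γ) ≤ |V(Γ)|` for the vertex-transitive graph `Γ = Cay(G,E)`. Tight for the
`⟨2,2,2⟩` triple `{1,(12)},{1,(13)},{1,(23)}` of `S₃` (`2·3 = 6`). -/
def CliqueCocliqueTPP : Prop :=
  ∀ (G : Type) [Group G] [Fintype G] [DecidableEq G] (S T U : Finset G),
    TripleProductProperty S T U → T.Nonempty → U.Nonempty →
      S.card * (T.card + U.card - 1) ≤ Fintype.card G

/-- A real function on a finite group is **positive definite** (`∑ c̄_g c_h h(g h⁻¹) ≥ 0`). -/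
def IsPosDef {G : Type*} [Group G] [Fintype G] (h : G → ℝ) : Prop :=
  ∀ c : G → ℂ, 0 ≤ (∑ g, ∑ g', (starRingEnd ℂ) (c g) * c g' * (h (g * g'⁻¹) : ℂ)).re

/-- **Delsarte / ratio bound for cocliques of a Cayley graph (weak duality, provable now):**
if `h` is positive definite, `h 1 = 1`, and `h` vanishes off `E ∪ {1}`, then every `S` with
`(Q(S) \ {1}) ∩ E = ∅` satisfies `|S| · ∑_g h(g) ≤ |G|`. (With `h = 1_K ∗ 1_{K⁻¹}/|K|` for a clique
`K` this is clique–coclique.) -/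
def DelsarteCocliqueBound : Prop :=
  ∀ (G : Type) [Group G] [Fintype G] [DecidableEq G] (E S : Finset G) (h : G → ℝ),
    IsPosDef h → h 1 = 1 → (∀ g, g ∉ E → g ≠ 1 → h g = 0) →
      (∀ s ∈ S, ∀ s' ∈ S, s ≠ s' → s * s'⁻¹ ∉ E) →
        (S.card : ℝ) * ∑ g, h g ≤ Fintype.card G

/-- Every SUBGROUP contained (as a set) in `E ∪ {1}` is a clique; hence (provable now from
`DelsarteCocliqueBound` or directly by coset counting) `|S| · |K| ≤ |G|`. -/
def SubgroupCliqueBound : Prop :=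
  ∀ (G : Type) [Group G] [Fintype G] [DecidableEq G] (S T U : Finset G) (K : Subgroup G),
    TripleProductProperty S T U → (∀ k ∈ K, k = 1 ∨ k ∈ conn T U) →
      S.card * Nat.card K ≤ Fintype.card G

/-- Pairwise quotient-disjointness `Q(T) ∩ Q(U) = {1}` (what the TPP gives each pair). -/
def QuotDisjoint {G : Type*} [Group G] (T U : Finset G) : Prop :=
  ∀ t ∈ T, ∀ t' ∈ T, ∀ u ∈ U, ∀ u' ∈ U, t * t'⁻¹ = u * u'⁻¹ → t = t' ∧ u = u'

/-- `X` is hyperoctahedrally hosted: after a right translation every element commutes with one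
fixed-point-free involution `μ` (i.e. `X ⊆ C(μ)·a⁻¹`, `C(μ) = B(M) ≅ S₂ ≀ S_{n/2}`). -/
def HyperHosted {n : ℕ} (X : Finset (Equiv.Perm (Fin n))) : Prop :=
  ∃ μ : Equiv.Perm (Fin n), μ * μ = 1 ∧ (∀ x, μ x ≠ x) ∧
    ∃ a : Equiv.Perm (Fin n), ∀ x ∈ X, (x * a) * μ = μ * (x * a)

/-- **Crux-level conjecture of card 1 (PairCliqueDichotomy), a statement about PAIRS only:**
two bump-free sets with disjoint quotient sets and near-extremal packing `|T||U| ≥ n! e^{-2c√n}`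
either have a SUBGROUP of order `≥ |T||U| e^{c√n}/√(n!)` inside `Q(U)Q(T) ∪ Q(T)Q(U) ∪ {1}`
(a clique of the quotient Cayley graph), or are both hyperoctahedrally hosted. No triple, no
TPP, no cancellation: a growth/covering statement for the 4-fold product set `UU⁻¹TT⁻¹`. -/
def PairCliqueDichotomy : Prop :=
  ∃ ε : ℝ, 0 < ε ∧ ∀ c : ℝ, 0 < c → ∃ n₀ : ℕ, ∀ n ≥ n₀, ∀ T U : Finset (Equiv.Perm (Fin n)),
    BumpFree ε T → BumpFree ε U → QuotDisjoint T U →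
      (n.factorial : ℝ) * Real.exp (-(2 * c * Real.sqrt (n : ℝ))) ≤ ((T.card * U.card : ℕ) : ℝ) →
        (∃ K : Subgroup (Equiv.Perm (Fin n)), (∀ k ∈ K, k = 1 ∨ k ∈ conn T U) ∧
            ((T.card * U.card : ℕ) : ℝ) * Real.exp (c * Real.sqrt (n : ℝ)) ≤
              (Nat.card K : ℝ) * Real.sqrt (n.factorial : ℝ)) ∨
        (HyperHosted T ∧ HyperHosted U)

/-- Glue of card 1 (provable now): packing `|S||T| ≤ n!` (tree `RealizesTPP.mul_le_card`) puts
every pair of an above-threshold triple in the range of `PairCliqueDichotomy`; a subgroup clique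
for any pair contradicts the threshold via `SubgroupCliqueBound`; otherwise all three sets are
hosted, right-translate them into the centralisers (`Finset.image (· * a)`, TPP and cardinalities
invariant) and apply the route crux `HyperoctahedralSubsets` (constants: take `c ≤ c_H`). -/
def CliqueLineToGlobalBranch : Prop :=
  SubgroupCliqueBound → PairCliqueDichotomy → HyperoctahedralSubsets → GlobalBranch

/-! ## Card 2 — psd-hexagon-cubic-packing -/

/-- The hexagon count: TPP holds iff the number of solutions of
`s s'⁻¹ (t t'⁻¹) (u u'⁻¹) = 1` is exactly `|S||T||U|` (the diagonal ones). Provable now. Its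
Fourier form is `∑_λ d_λ Tr(ρ̂_S ρ̂_T ρ̂_U)(λ) = |G|/(|S||T||U|)` with PSD contractions `ρ̂_X`. -/
def HexagonCount : Prop :=
  ∀ (G : Type) [Group G] [Fintype G] [DecidableEq G] (S T U : Finset G),
    TripleProductProperty S T U ↔
      ((((S ×ˢ S) ×ˢ (T ×ˢ T)) ×ˢ (U ×ˢ U)).filter
          (fun x => x.1.1.1 * x.1.1.2⁻¹ * (x.1.2.1 * x.1.2.2⁻¹) * (x.2.1 * x.2.2⁻¹) = 1)).card =
        S.card * T.card * U.card

/-- Pairwise consequence: TPP ⇒ the equation `s s'⁻¹ = t' t⁻¹` has exactly `|S||T|` solutions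
(Fourier form `∑_λ d_λ Tr(ρ̂_S ρ̂_T) = |G|/(|S||T|)`). Provable now. -/
def PairQuotientCount : Prop :=
  ∀ (G : Type) [Group G] [Fintype G] [DecidableEq G] (S T U : Finset G),
    TripleProductProperty S T U →
      (((S ×ˢ S) ×ˢ (T ×ˢ T)).filter
          (fun x => x.1.1 * x.1.2⁻¹ * (x.2.1 * x.2.2⁻¹) = 1)).card = S.card * T.card

/-- **Cubic packing for symmetric groups (conjecture; the transfer target C⁺ in its clean form):**
a TPP triple in `S_n` never beats the sum of the cubes, `|S||T||U| ≤ ∑_λ (f^λ)³`.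
True and tight for abelian groups (Cohn–Umans Lemma 3.1), false in some groups (CKSU 2005 §2),
consistent with everything known in `S_n`; implies `NoThresholdSubsetTriple` with the
Vershik–Kerov constant. -/
def CubicPackingSn : Prop :=
  ∀ n : ℕ, ∀ S T U : Finset (Equiv.Perm (Fin n)), TripleProductProperty S T U →
    ((S.card * T.card * U.card : ℕ) : ℝ) ≤ charDegreePowSum (Equiv.Perm (Fin n)) 3

/-- **Bump-free cubic packing (C⁺ of card 2, eventually and up to `e^{o(√n)}`):** -/
def BumpFreeCubicPacking : Prop :=
  ∃ ε : ℝ, 0 < ε ∧ ∀ δ : ℝ, 0 < δ → ∃ n₀ : ℕ, ∀ n ≥ n₀, ∀ S T U : Finset (Equiv.Perm (Fin n)),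
    TripleProductProperty S T U → BumpFree ε S → BumpFree ε T → BumpFree ε U →
      ((S.card * T.card * U.card : ℕ) : ℝ) ≤
        charDegreePowSum (Equiv.Perm (Fin n)) 3 * Real.exp (δ * Real.sqrt (n : ℝ))

/-- `∑ d³ ≤ d_max · ∑ d² = d_max · n!` (provable now from the named facts `sum_sq_charDegrees`,
`irrChars_finite`, `le_maxCharDegree`). -/
def CubesLeMaxDegMulOrder : Prop :=
  ∀ n : ℕ, charDegreePowSum (Equiv.Perm (Fin n)) 3 ≤
    (maxCharDegree (Equiv.Perm (Fin n)) : ℝ) * (n.factorial : ℝ)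

/-- Glue of card 2 (provable now, the arithmetic of `closes`): with Vershik–Kerov's upper bound
`d_max(S_n) ≤ √(n!) e^{-(c₂-ε)√n}` (tree THEOREM `VershikKerov1985_maxCharDegree_holds`),
`BumpFreeCubicPacking` at `δ := c₂/4` gives `GlobalBranch` with `c = c₂/4`. -/
def CubicToGlobalBranch : Prop :=
  BumpFreeCubicPacking → CubesLeMaxDegMulOrder → VershikKerov1985_maxCharDegree → GlobalBranch

/-! ## Card 1, quotient side — host dichotomy via large-subgroup classification -/

/-- Quotient confinement is a coset statement: `Q(X) ⊆ H ↔ X` lies in one right coset of `H`.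
Provable now. -/
def QuotInSubgroupIffRightCoset : Prop :=
  ∀ (G : Type) [Group G] [DecidableEq G] (X : Finset G) (H : Subgroup G), X.Nonempty →
    ((∀ x ∈ X, ∀ x' ∈ X, x * x'⁻¹ ∈ H) ↔ ∃ a : G, ∀ x ∈ X, x * a⁻¹ ∈ H)

/-- Point-stabiliser hosts are 1-umvirates (hence bumpy: bump `n` at level 1): if every
quotient `s s'⁻¹` fixes `p` then all `s ∈ S` map one point `q` to `p`. Provable now. -/
def StabHostIsUmvirate : Prop :=
  ∀ (n : ℕ) (S : Finset (Equiv.Perm (Fin n))) (p : Fin n), S.Nonempty →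
    (∀ s ∈ S, ∀ s' ∈ S, (s * s'⁻¹) p = p) → ∃ q : Fin n, ∀ s ∈ S, s q = p

/-- **Praeger–Saxl 1980** (orders of primitive groups): a primitive subgroup of `S_n` not
containing `A_n` has order `≤ 4^n` — the TREE's named fact
`Literature.GroupTheory.PermutationGroups.PraegerSaxl1980_card_le` (PrimitiveGroupOrder.lean; also
`Maroti2002_cor11ii`: `< 50·n^{√n}`). Consequence used: every subgroup of order `> 4^n` is
intransitive or imprimitive or `⊇ A_n`. -/
def PraegerSaxl1980 : Prop :=
  Literature.GroupTheory.PermutationGroups.PraegerSaxl1980_card_le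

/-- The consequence in the form the host classification needs (provable now from the fact and
`MulAction.IsPreprimitive` API: not preprimitive ⇒ intransitive or admits a nontrivial block). -/
def LargeSubgroupNotPrimitive : Prop :=
  PraegerSaxl1980 → ∀ n : ℕ, ∀ H : Subgroup (Equiv.Perm (Fin n)),
    (4 : ℝ) ^ n < (Nat.card H : ℝ) → ¬ alternatingGroup (Fin n) ≤ H →
      ¬ MulAction.IsPreprimitive H (Fin n)

/-- **Crux-level conjecture of card 3 (HostDichotomy):** bump-free TPP triples above the
`e^{-c√n}` threshold are hyperoctahedrally hosted: after right translations, each set commutes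
with a fixed-point-free involution (lies in `C(μ_i) = B(M_i) ≅ S₂ ≀ S_{n/2}`). -/
def HostDichotomy : Prop :=
  ∃ ε : ℝ, 0 < ε ∧ ∀ c : ℝ, 0 < c → ∃ n₀ : ℕ, ∀ n ≥ n₀, ∀ S T U : Finset (Equiv.Perm (Fin n)),
    TripleProductProperty S T U → BumpFree ε S → BumpFree ε T → BumpFree ε U →
      (n.factorial : ℝ) ^ ((3 : ℝ) / 2) * Real.exp (-(c * Real.sqrt (n : ℝ))) <
          ((S.card * T.card * U.card : ℕ) : ℝ) →
        ∃ μ : Fin 3 → Equiv.Perm (Fin n), (∀ i, μ i * μ i = 1 ∧ ∀ x, μ i x ≠ x) ∧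
          ∃ a : Fin 3 → Equiv.Perm (Fin n),
            (∀ s ∈ S, (s * a 0) * μ 0 = μ 0 * (s * a 0)) ∧
            (∀ t ∈ T, (t * a 1) * μ 1 = μ 1 * (t * a 1)) ∧
            (∀ u ∈ U, (u * a 2) * μ 2 = μ 2 * (u * a 2))

/-- Glue of card 3 (provable now: right-translate into the centralisers with
`Finset.image (· * a i)`, TPP and cardinalities are invariant, apply the route crux
`HyperoctahedralSubsets`, compare constants). -/
def HostToGlobalBranch : Prop :=
  HostDichotomy → HyperoctahedralSubsets → GlobalBranch

end Summit.MatrixMultiplication.MatrixMultiplication.Cruxes.GlobalBranch.Sketch
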